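import Summits.BirchSwinnertonDyer.BirchSwinnertonDyer.Theorems.GenusKolyvaginAtTwoPowDvdShaCardAtTwoRTPrimeSwapping
import HarnessLib

/-!
# Route `GenusKolyvaginAtTwo`, crux L_T `PowDvdShaCardAtTwoRT` (stmt-BirchSwinnertonDyer-23242), LINE 18 stub 3a⁗ —
# the SWAP ORACLE from Kolyvagin's TWO-PRIME reciprocity (every arithmetic input displayed), and the separating set it yields

LEAD seat `bsd-line-gk2-p1` g15 (cell `bsd-f1-sign2`), `--supports stmt-BirchSwinnertonDyer-23242` (helper). Pure bookkeeping over
gk2-p2 g15's loop `exists_good_separating_of_swapOracle` (`…RTPrimeSwapping`, p686702); THEOREMS ONLY. BSD is not proved by this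
file; neither is the crux or the stub.

WHY (memo `Cruxes/PowDvdShaCardAtTwoRT/Lines/plus-descent-lead-g15.md`, §1–§2). The loop's ORACLE — «for admissible `S` (`#S = r`,
`ν(S) = M_r`), `ℓ₀ ∈ S` and `c ∈ C[p]`, a good `ℓ′ ∉ S` with `c_{λ′} ≠ 0` and `insert ℓ′ (S ∖ ℓ₀)` admissible» — was to be discharged
by McCallum's (10)–(13) with a level-`p` auxiliary class; that argument is void at rungs with `M_r ≥ 1` (the λ′-term of (13) is a
pairing against `p^{M_r}·d_{M_r+1}(nℓ′)_{λ′} = 0`). Kolyvagin's own engine (Math. Ann. 291 (1991) Thm. 2.1 via [LNM 1479, Prop. 8],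
all classes at one HIGH level `M`) replaces it: the reciprocity law for the PAIR of Kolyvagin classes `c_M(n/ℓ₀·ℓ′)`, `c_M(n)` has
exactly two surviving terms, at `λ′` and `λ₀` (Kummer × Kummer and transverse × transverse terms vanish — Lemma 4.3 and the isotropy
of the transverse condition), and by local duality in Frobenius coordinates (Prop. 4.4 value form; at `p = 2` over `K` the LOST-BIT
LAW `lostBit_addOrderOf_pairing_fixed_antifixed`, p690522 — one bit lost at EACH place, cancelling) the equality of the two orders
reads, in local `2`-DIVISIBILITY exponents `d_S(ℓ)` of `P_{∏S}` in `E(K_λ)/p^M`,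
  `d_{S∖ℓ₀}(ℓ′) + d_S(ℓ′) = d_{S∖ℓ₀}(ℓ₀) + d_{S′}(ℓ₀)`, `S′ = insert ℓ′ (S ∖ ℓ₀)`, whenever the left side is `≤ M − 2`.
Čebotarev (I4′: full local order at `λ′` for `c_M(n/ℓ₀)` and `c_M(n)`, plus detection of `c`) makes the left side
`m(S∖ℓ₀) + M_r`; since local divisibility dominates global (`m ≤ d`), `d_{S′}(ℓ₀) ≤ M_r`, hence `m(S′) ≤ M_r`, hence `= M_r` by
minimality: the swap KEEPS the divisibility index. This file is exactly that deduction, abstractly: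

* `swapOracle_of_twoPrimeReciprocity` — the loop's `oracle` binder from: (hceb) Čebotarev I4′; (hrec) the two-term order identity with
  its informativeness guard; (hloc) `m ≤ d`; (hmin) minimality of `M_r` among admissible-size sets of admissible primes; (hM) the side
  condition `m(S ∖ ℓ₀) + M_r + 2 ≤ M` (Kolyvagin's «`n′ = n + m_f`»); (hInv) the dictionary of the invariant.
* `exists_good_separating_of_twoPrimeReciprocity` — plugged into gk2-p2's loop: an admissible set of GOOD primes whose strict
  conditions separate `C`.

References: [Kolyvagin1991MathAnn] Thm. 2.1, 2.2 (and [1, Prop. 8] cited there); [McCallumLMS1991] §5 Prop. 5.2 (proof), Prop. 4.4,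
Lemma 4.3, Lemma 5.3; [GrossLMS1991] Prop. 6.2.
-/

set_option autoImplicit false
-- `Summit.<P>.<Sub>` repeats `BirchSwinnertonDyer` by the tree's layout convention (D-0017)
set_option linter.dupNamespace false

namespace Summit.BirchSwinnertonDyer.BirchSwinnertonDyer.Theorems.GenusExact.PlusDescent

open Finset

section TwoPrime

variable {V : Type*} [AddCommGroup V]

/-- **The swap oracle from Kolyvagin's two-prime reciprocity** (replaces McCallum's (10)–(13) at every rung). Data over a set of
prime labels `ℕ`: admissibility `adm` of a single prime (Kolyvagin at `2`, level `≥ M`), `good` (whatever the loop calls good —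
implied by `adm` via `hgood`), the global divisibility index `m S` of `P_{∏S}` and its local divisibility `dl S ℓ` at the place over
`ℓ` (both read in `E(·)/p^M`, so `≤ M`), the rung `Mr` and size `r`, the strict local conditions `A ℓ` and the subgroup `Cp` whose
elements are to be detected. Hypotheses: `hInv_out`/`hInv_in` (the invariant IS «`#S = r`, all primes admissible, `m S = Mr`»);
`hmin` (minimality of `Mr`); `hloc` (global divisibility is at most local divisibility at an admissible prime outside the product);
`hceb` (Čebotarev I4′: a new admissible prime at which `c_M(∏(S∖ℓ₀))` and `c_M(∏S)` have FULL local order — local divisibility =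
global — and which detects `c`); `hrec` (the two-term reciprocity in divisibility exponents, read through the local duality law,
under its informativeness guard); `hM` (the guard holds: `m(S∖ℓ₀) + Mr + 2 ≤ M`). Conclusion: the `oracle` binder of
`exists_good_separating_of_swapOracle`. [cite: Kolyvagin1991MathAnn, Thm. 2.1 (proof via [1, Prop. 8])]
[cite: McCallumLMS1991, §5 Prop. 5.2 (proof), Prop. 4.4] -/
theorem swapOracle_of_twoPrimeReciprocity
    (Cp : AddSubgroup V) (A : ℕ → AddSubgroup V) (good adm : ℕ → Prop) (Inv : Finset ℕ → Prop)
    (m : Finset ℕ → ℕ) (dl : Finset ℕ → ℕ → ℕ) (M Mr r : ℕ)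
    (hgood : ∀ l, adm l → good l)
    (hInv_out : ∀ S, Inv S → S.card = r ∧ (∀ l ∈ S, adm l) ∧ m S = Mr)
    (hInv_in : ∀ S, S.card = r → (∀ l ∈ S, adm l) → m S = Mr → Inv S)
    (hmin : ∀ S, S.card = r → (∀ l ∈ S, adm l) → Mr ≤ m S)
    (hloc : ∀ S l, (∀ l' ∈ S, adm l') → adm l → l ∉ S → m S ≤ dl S l)
    (hceb : ∀ S, Inv S → ∀ l₀ ∈ S, ∀ c ∈ Cp, ∃ l', l' ∉ S ∧ adm l' ∧
      dl (S.erase l₀) l' = m (S.erase l₀) ∧ dl S l' = m S ∧ (c ≠ 0 → c ∉ A l'))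
    (hrec : ∀ S, Inv S → ∀ l₀ ∈ S, ∀ l', l' ∉ S → adm l' →
      dl (S.erase l₀) l' + dl S l' + 2 ≤ M →
      dl (S.erase l₀) l' + dl S l' = dl (S.erase l₀) l₀ + dl (insert l' (S.erase l₀)) l₀)
    (hM : ∀ S, Inv S → ∀ l₀ ∈ S, m (S.erase l₀) + Mr + 2 ≤ M) :
    ∀ S, Inv S → ∀ l₀ ∈ S, ∀ c ∈ Cp,
      ∃ l', l' ∉ S ∧ good l' ∧ Inv (insert l' (S.erase l₀)) ∧ (c ≠ 0 → c ∉ A l') := by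
  classical
  intro S hS l₀ hl₀ c hc
  obtain ⟨hcard, hadm, hmS⟩ := hInv_out S hS
  obtain ⟨l', hl'S, hl'adm, hd₀, hdS, hdet⟩ := hceb S hS l₀ hl₀ c hc
  refine ⟨l', hl'S, hgood l' hl'adm, ?_, hdet⟩
  -- admissible primes of the pieces
  have hadm₀ : ∀ l ∈ S.erase l₀, adm l := fun l hl ↦ hadm l (Finset.mem_of_mem_erase hl)
  have hadm' : ∀ l ∈ insert l' (S.erase l₀), adm l := by
    intro l hl
    rcases Finset.mem_insert.mp hl with rfl | hl
    · exact hl'adm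
    · exact hadm₀ l hl
  have hl₀' : l₀ ∉ insert l' (S.erase l₀) := by
    intro h
    rcases Finset.mem_insert.mp h with h | h
    · exact hl'S (h ▸ hl₀)
    · exact (Finset.notMem_erase l₀ S) h
  have hcard' : (insert l' (S.erase l₀)).card = r := by
    rw [Finset.card_insert_of_notMem (fun h ↦ hl'S (Finset.mem_of_mem_erase h)), Finset.card_erase_of_mem hl₀, hcard]
    have : 0 < S.card := Finset.card_pos.mpr ⟨l₀, hl₀⟩
    omega
  -- the two-term identity is informative
  have hguard : dl (S.erase l₀) l' + dl S l' + 2 ≤ M := by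
    rw [hd₀, hdS, hmS]
    exact hM S hS l₀ hl₀
  have hid := hrec S hS l₀ hl₀ l' hl'S hl'adm hguard
  rw [hd₀, hdS, hmS] at hid
  -- `m(S∖l₀) ≤ dl (S∖l₀) l₀`, so the new local divisibility at `l₀` is `≤ Mr`
  have h1 : m (S.erase l₀) ≤ dl (S.erase l₀) l₀ :=
    hloc (S.erase l₀) l₀ hadm₀ (hadm l₀ hl₀) (Finset.notMem_erase l₀ S)
  have h2 : dl (insert l' (S.erase l₀)) l₀ ≤ Mr := by omega
  -- hence the new global divisibility is `≤ Mr`, hence `= Mr`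
  have h3 : m (insert l' (S.erase l₀)) ≤ Mr :=
    (hloc _ l₀ hadm' (hadm l₀ hl₀) hl₀').trans h2
  have h4 : Mr ≤ m (insert l' (S.erase l₀)) := hmin _ hcard' hadm'
  exact hInv_in _ hcard' hadm' (le_antisymm h3 h4)

/-- **McCallum's Prop. 5.2 separation from the two-prime engine**: the hypotheses of `swapOracle_of_twoPrimeReciprocity` fed into
gk2-p2's loop `exists_good_separating_of_swapOracle` give an admissible `S` of good primes whose strict local conditions separate
`C`: `C ∩ ⋂_{ℓ∈S} A ℓ = 0`. [cite: McCallumLMS1991, §5 Prop. 5.2] [cite: Kolyvagin1991MathAnn, Thm. 2.1] -/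
theorem exists_good_separating_of_twoPrimeReciprocity {p : ℕ} (hp : p.Prime) {M : ℕ} (hV : ∀ v : V, p ^ M • v = 0)
    (C : AddSubgroup V) [Finite C] {d r : ℕ}
    (hd : Nat.card ↥(C ⊓ AddSubgroup.torsionBy V (p : ℤ)) = p ^ d) (hdr : d ≤ r)
    (A : ℕ → AddSubgroup V) (good adm : ℕ → Prop) (Inv : Finset ℕ → Prop)
    (m : Finset ℕ → ℕ) (dl : Finset ℕ → ℕ → ℕ) (M' Mr : ℕ)
    (hgood : ∀ l, adm l → good l)
    (hInv_out : ∀ S, Inv S → S.card = r ∧ (∀ l ∈ S, adm l) ∧ m S = Mr)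
    (hInv_in : ∀ S, S.card = r → (∀ l ∈ S, adm l) → m S = Mr → Inv S)
    (hmin : ∀ S, S.card = r → (∀ l ∈ S, adm l) → Mr ≤ m S)
    (hloc : ∀ S l, (∀ l' ∈ S, adm l') → adm l → l ∉ S → m S ≤ dl S l)
    (hceb : ∀ S, Inv S → ∀ l₀ ∈ S, ∀ c ∈ C ⊓ AddSubgroup.torsionBy V (p : ℤ), ∃ l', l' ∉ S ∧ adm l' ∧
      dl (S.erase l₀) l' = m (S.erase l₀) ∧ dl S l' = m S ∧ (c ≠ 0 → c ∉ A l'))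
    (hrec : ∀ S, Inv S → ∀ l₀ ∈ S, ∀ l', l' ∉ S → adm l' →
      dl (S.erase l₀) l' + dl S l' + 2 ≤ M' →
      dl (S.erase l₀) l' + dl S l' = dl (S.erase l₀) l₀ + dl (insert l' (S.erase l₀)) l₀)
    (hM : ∀ S, Inv S → ∀ l₀ ∈ S, m (S.erase l₀) + Mr + 2 ≤ M')
    (hK : ∀ l, good l → (A l).relIndex (C ⊓ AddSubgroup.torsionBy V (p : ℤ)) ∣ p)
    (S₀ : Finset ℕ) (hS₀ : Inv S₀) :
    ∃ S, Inv S ∧ (∀ l ∈ S, good l) ∧ C ⊓ (⨅ l ∈ S, A l) = ⊥ :=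
  exists_good_separating_of_swapOracle hp hV C hd hdr A good Inv (fun S hS ↦ (hInv_out S hS).1) hK S₀ hS₀
    (swapOracle_of_twoPrimeReciprocity (C ⊓ AddSubgroup.torsionBy V (p : ℤ)) A good adm Inv m dl M' Mr r hgood hInv_out
      hInv_in hmin hloc hceb hrec hM)

end TwoPrime

end Summit.BirchSwinnertonDyer.BirchSwinnertonDyer.Theorems.GenusExact.PlusDescent
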